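import Literature.Topology.FourManifolds.SPC4MorseExistence
import Literature.Topology.FourManifolds.BoundaryFlowout
import Literature.Topology.FourManifolds.RegularSlabField
import Literature.Topology.FourManifolds.CollarExtension
import Literature.Topology.FourManifolds.SPC4HandlesProofs
import HarnessLib

/-!
# The collar neighbourhood theorem for compact manifolds with boundary

Topic `Literature/Topology/FourManifolds` (fact seat
`provefact-Literature.SPC4.exists_diffeomorph_comp_incl_eq`, leaf F4b of the DAG recorded in
`SPC4HandlesProofs.lean`).  Everything here is proved.

* `Literature.Topology.FourManifolds.BoundaryData.nonempty_collar_of_compactSpace` — **the boundary of a compact smooth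
  manifold with boundary of dimension `n + 2 ≥ 2` admits a collar** (`Literature.Topology.FourManifolds.BoundaryData.Collar`
  of `Gluing.lean`: a smooth embedding `∂M × [0, 1] ↪ M` for the product model with corners,
  open image of `∂M × [0, 1)`, the boundary inclusion on `∂M × {0}`), for every boundary datum.
  This is the compact case of the tree's named fact `Literature.Topology.FourManifolds.BoundaryData.nonempty_collar`
  (Hirsch, *Differential Topology* (1976), Thm. 4.6.1; M. Brown, Ann. Math. 75 (1962) for the
  topological version; Milnor, *Lectures on the h-cobordism theorem* (1965), §1).  Proof along
  Milnor's proof of Thm. 3.4 (ibid.): a boundary-defining function `f` (Lemma 2.6,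
  `SPC4MorseExistence.lean`) and a smooth vector field `ξ` with `ξ(f) = 1` near `∂M`
  (`RegularSlabField.lean`;
  packaged as `Literature.Topology.FourManifolds.FlowoutInput`, `nonempty_flowoutInput`), the flow-out of `∂M` along `ξ` with
  its explicit inverse `z ↦ (ψ_z(-f z), f z)` (`BoundaryFlowout.lean`, ODE input
  `HalfSpaceFlow.lean` / `FlowWithin.lean`, uniqueness `IntegralCurveBoundary.lean`), and the
  chart criterion `CollarCriterion.lean`; an empty boundary has the vacuous collar
  (`BoundaryData.collarOfIsEmpty`).  The non-compact case of `nonempty_collar` is not treated.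
* `Literature.Topology.FourManifolds.BoundaryData.diffeoExtends_of_isDiffeotopicToId_holds` — **discharge of the named fact
  `Literature.Topology.FourManifolds.BoundaryData.diffeoExtends_of_isDiffeotopicToId`** of `SPC4HandlesProofs.lean` (Hirsch
  1976, Ch. 8 §2, proof of Thm. 2.3: on a compact manifold with boundary a boundary
  diffeomorphism diffeotopic to the identity extends), via `CollarExtension.lean`
  (`BoundaryData.exists_diffeomorph_comp_incl_eq_of_isDiffeotopicToId`, dimension `≥ 2`;
  dimension `1` by discreteness, `Diffeomorph.eq_refl_of_isDiffeotopicToId_fin_zero`).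
* `Literature.Topology.FourManifolds.exists_diffeomorph_comp_incl_eq_of_laudenbachPoenaru'` — the assembly of
  Laudenbach–Poénaru's extension theorem `Literature.Topology.FourManifolds.exists_diffeomorph_comp_incl_eq` from the
  remaining four named facts (Lemma 2, the orientation-preserving extension of the proof of
  Thm. A, the orientation-reversing extendable diffeomorphism, connectedness of the boundary of
  a `1`-handlebody), the collar fact being discharged.

## References

* M. W. Hirsch, *Differential Topology*, GTM 33 (1976), Thm. 4.6.1 (collars); Ch. 8 §2, proof
  of Thm. 2.3 (extension over a collar). [Hirsch1976] [HirschDT1976]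
* J. Milnor, *Lectures on the h-cobordism theorem*, Princeton (1965), §1 and proof of Thm. 3.4.
  [MilnorHCobordism1965]
* F. Laudenbach, V. Poénaru, *A note on 4-dimensional handlebodies*, Bull. Soc. Math. France
  100 (1972), 337–344, §2. [LaudenbachPoenaruBSMF1972]
-/

open scoped Manifold ContDiff Topology
open Set Function

noncomputable section

namespace Literature.Topology.FourManifolds

universe u

/-! ### The collar of an empty boundary -/

/-- A boundary datum with empty carrier has a (vacuous) collar. [folklore] -/
def BoundaryData.collarOfIsEmpty {n : ℕ} {M : Type u} [TopologicalSpace M]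
    [ChartedSpace (EuclideanHalfSpace (n + 2)) M] (b : BoundaryData (𝓡∂ (n + 2)) M (𝓡 (n + 1)))
    [IsEmpty b.carrier] : b.Collar where
  toFun p := isEmptyElim p.1
  isSmoothEmbedding :=
    ⟨⟨PUnit, inferInstance, inferInstance, fun p => isEmptyElim p.1⟩,
      Topology.IsEmbedding.of_subsingleton _⟩
  isOpen_image := by
    rw [Set.eq_empty_of_isEmpty {p : b.carrier × Set.Icc (0 : ℝ) 1 | (p.2 : ℝ) < 1}, image_empty]
    exact isOpen_empty
  apply_bot x := isEmptyElim x

/-! ### Flow-out input on a compact manifold with nonempty boundary -/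

section Input

variable {n : ℕ} {M : Type u} [TopologicalSpace M] [T2Space M] [CompactSpace M]
  [ChartedSpace (EuclideanHalfSpace (n + 2)) M] [IsManifold (𝓡∂ (n + 2)) ∞ M]

/-- **Flow-out input exists on every compact manifold with boundary**: Milnor's
boundary-defining function (Lemma 2.6: the tree's `Literature.Topology.FourManifolds.exists_contMDiff_eq_one_on_boundary` of
`SPC4MorseExistence.lean` gives `f₁` smooth with `f₁ = 1` and `df₁ ≠ 0` on `∂M`, `f₁ < 1`
inside; put `f = 1 - f₁`) is `≥ 0`, vanishes exactly on `∂M` and is regular there, hence on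
some `{f < 2δ}` (`Literature.Topology.FourManifolds.exists_pos_forall_mfderiv_ne_zero`), and
`Literature.Topology.FourManifolds.exists_contMDiffSection_mlineDeriv_eq_one_on` (`RegularSlabField.lean`) provides `ξ` with
`ξ(f) = 1` on the closed set `{f ≤ δ}` of regular points (Milnor 1965, proof of Thm. 3.4).
[cite: MilnorHCobordism1965, Lemma 2.6 and proof of Thm. 3.4] -/
theorem nonempty_flowoutInput : Nonempty (FlowoutInput (n + 1) M) := by
  classical
  obtain ⟨f₁, hf₁, hbd, hint⟩ := exists_contMDiff_eq_one_on_boundary (n := n + 1) (M := M)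
  set f : M → ℝ := fun z => 1 - f₁ z with hf
  have hfs : ContMDiff (𝓡∂ (n + 2)) 𝓘(ℝ, ℝ) ∞ f :=
    ((contDiff_const (c := (1 : ℝ))).sub contDiff_id).contMDiff.comp hf₁
  have hfb : ∀ z, f z = 0 ↔ z ∈ (𝓡∂ (n + 2)).boundary M := by
    intro z
    constructor
    · intro hz
      by_contra hzb
      have hzi : (𝓡∂ (n + 2)).IsInteriorPoint z :=
        ((𝓡∂ (n + 2)).isInteriorPoint_or_isBoundaryPoint z).resolve_right hzb
      have h := hint z hzi
      simp only [hf] at hz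
      linarith
    · intro hz
      simp only [hf, (hbd z hz).1, sub_self]
  have hf0 : ∀ z, 0 ≤ f z := by
    intro z
    rcases (𝓡∂ (n + 2)).isInteriorPoint_or_isBoundaryPoint z with hzi | hzb
    · have h := hint z hzi
      simp only [hf]; linarith
    · simp only [hf, (hbd z hzb).1, sub_self, le_refl]
  have hreg : ∀ z, f z = 0 → mfderiv (𝓡∂ (n + 2)) 𝓘(ℝ, ℝ) f z ≠ 0 := by
    intro z hz hcrit
    have hzb := (hfb z).1 hz
    have hfz : HasMFDerivAt (𝓡∂ (n + 2)) 𝓘(ℝ, ℝ) f z 0 :=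
      hcrit ▸ (hfs.mdifferentiableAt (by simp)).hasMFDerivAt
    have h1 := (hasMFDerivAt_const (I := 𝓡∂ (n + 2)) (I' := 𝓘(ℝ, ℝ)) (1 : ℝ) z).sub hfz
    have heq : ((fun _ : M => (1 : ℝ)) - f) = f₁ := by
      funext x; simp [hf]
    rw [heq] at h1
    have h2 : mfderiv (𝓡∂ (n + 2)) 𝓘(ℝ, ℝ) f₁ z = 0 := by
      rw [h1.mfderiv]; exact sub_self _
    exact (hbd z hzb).2 h2
  obtain ⟨δ', hδ', hδ'reg⟩ := exists_pos_forall_mfderiv_ne_zero hfs hf0 hreg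
  set δ := δ' / 2 with hδ
  have hδpos : 0 < δ := by positivity
  have hreg2 : ∀ z ∈ {z : M | f z ≤ δ}, mfderiv (𝓡∂ (n + 2)) 𝓘(ℝ, ℝ) f z ≠ 0 := fun z hz =>
    hδ'reg z (by simp only [mem_setOf_eq] at hz; linarith)
  obtain ⟨ξ, hξ⟩ := exists_contMDiffSection_mlineDeriv_eq_one_on hfs
    (isClosed_le hfs.continuous continuous_const) hreg2
  exact ⟨⟨f, ξ, δ, hδpos, hfs, hf0, hfb, ξ.contMDiff, fun z hz => hξ z hz⟩⟩

end Input

/-! ### The collar theorem and the collar fact of `SPC4HandlesProofs.lean` -/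

/-- **Collar neighbourhood theorem, compact case.**  The boundary of a compact smooth
`(n+2)`-manifold with boundary `M` (Hausdorff, model `𝓡∂ (n + 2)`) admits a collar: every
boundary datum `b` (model `𝓡 (n + 1)`) has a `b.Collar` in the sense of `Gluing.lean` — a smooth
embedding `∂M × [0, 1] ↪ M` for the product model with corners, with open image of
`∂M × [0, 1)`, restricting to `b.incl` on `∂M × {0}`.  This is the compact case of the tree's
named fact `Literature.Topology.FourManifolds.BoundaryData.nonempty_collar` (Hirsch, *Differential Topology* (1976),
Thm. 4.6.1; M. Brown (1962) for the topological version), proved along Milnor, *Lectures on the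
h-cobordism theorem* (1965), proof of Thm. 3.4: flow out from `∂M` along a vector field `ξ`
with `ξ(f) = 1` for a boundary-defining function `f` (`BoundaryDefiningFunction.lean`,
`BoundaryFlowout.lean`, ODE input `HalfSpaceFlow.lean`/`FlowWithin.lean`), the inverse being
`z ↦ (ψ_z(-f z), f z)`, and the chart bookkeeping of `CollarCriterion.lean`.
[cite: Hirsch1976, Thm. 4.6.1] [cite: MilnorHCobordism1965, proof of Thm. 3.4] -/
theorem BoundaryData.nonempty_collar_of_compactSpace (n : ℕ) (M : Type u) [TopologicalSpace M]
    [T2Space M] [CompactSpace M] [ChartedSpace (EuclideanHalfSpace (n + 2)) M]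
    [IsManifold (𝓡∂ (n + 2)) ∞ M] (b : BoundaryData (𝓡∂ (n + 2)) M (𝓡 (n + 1))) :
    Nonempty b.Collar := by
  rcases isEmpty_or_nonempty b.carrier with h | h
  · exact ⟨b.collarOfIsEmpty⟩
  · obtain ⟨D⟩ := nonempty_flowoutInput (n := n) (M := M)
    obtain ⟨Γ⟩ := D.nonempty_cover
    exact FlowoutInput.Cover.nonempty_collar b Γ

/-- **Discharge of the collar fact `Literature.Topology.FourManifolds.BoundaryData.diffeoExtends_of_isDiffeotopicToId`** of
`SPC4HandlesProofs.lean` (Hirsch 1976, Ch. 8 §2, proof of Thm. 2.3: a boundary diffeomorphism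
diffeotopic to the identity of a compact manifold with boundary extends): `CollarExtension.lean`
reduces it to a collar (`BoundaryData.exists_diffeomorph_comp_incl_eq_of_isDiffeotopicToId`,
dimension `≥ 2`; dimension `1` by discreteness), and the collar exists by
`BoundaryData.nonempty_collar_of_compactSpace`. [cite: HirschDT1976, Ch. 8 §2, proof of Thm. 2.3] -/
theorem BoundaryData.diffeoExtends_of_isDiffeotopicToId_holds :
    BoundaryData.diffeoExtends_of_isDiffeotopicToId.{u} := by
  intro n M _ _ _ _ _ _ b ψ hψ
  cases n with
  | zero =>
    rw [Diffeomorph.eq_refl_of_isDiffeotopicToId_fin_zero hψ]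
    exact ⟨Diffeomorph.refl _ M ∞, by simp [Diffeomorph.coe_refl]⟩
  | succ k =>
    haveI : CompactSpace b.carrier := b.compactSpace_carrier
    obtain ⟨c⟩ := BoundaryData.nonempty_collar_of_compactSpace k M b
    exact b.exists_diffeomorph_comp_incl_eq_of_isDiffeotopicToId c hψ

section SPC4

/-- **Assembly of Laudenbach–Poénaru's extension theorem with the collar fact discharged**:
`Literature.Topology.FourManifolds.exists_diffeomorph_comp_incl_eq` follows from the three `1`-handlebody facts
(Lemma 2; the orientation-preserving extension, proof of Thm. A; the orientation-reversing
extendable diffeomorphism) and the connectedness of the boundary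
(`Literature.Topology.FourManifolds.exists_diffeomorph_comp_incl_eq_of_laudenbachPoenaru` with
`BoundaryData.diffeoExtends_of_isDiffeotopicToId_holds`).
[cite: LaudenbachPoenaruBSMF1972, §2, pp. 341–342] -/
theorem exists_diffeomorph_comp_incl_eq_of_laudenbachPoenaru'
    (h₁ : laudenbachPoenaru_exists_diffeoExtends_mapOfEq_eq.{u})
    (h₂ : laudenbachPoenaru_diffeoExtends_of_isOrientationPreserving.{u})
    (h₃ : exists_diffeoExtends_isOrientationReversing.{u})
    (h₅ : connectedSpace_boundary_of_isHandlebodyOfIndexLE_one.{u}) :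
    exists_diffeomorph_comp_incl_eq.{u} :=
  exists_diffeomorph_comp_incl_eq_of_laudenbachPoenaru h₁ h₂ h₃
    BoundaryData.diffeoExtends_of_isDiffeotopicToId_holds h₅

end SPC4

end Literature.Topology.FourManifolds
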